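import Literature.NumberTheory.LFunctions.Zhang2022.ObjectiveTwinKernelGram

/-!
# Zhang (2022) design-space objective, twin part 5: the ℓ-slope form on `ker 𝔅` IS `D_K = π·diag(−16, 8, −16)`

Y. Zhang, *Discrete mean estimates and the Landau–Siegel zero*, arXiv:2211.02515v1 (2022)
[Zhang2022LandauSiegel] — an unrefereed manuscript under adjudication. **This file SEARCHES and TYPES; it
makes no claim about Landau–Siegel zeros, about Theorems 1–2 of the manuscript, or about a repaired (2.32),
until a kernel theorem says so.** Companion of `ObjectiveTwinEllSlope` / `ObjectiveTwinKernelGram` (CONTROL item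
C2a of the LANDAU–SIEGEL programme's OBJECTIVE.md §5). `ObjectiveTwinEllSlope` DEFINED the slope form
`ellSlopeQ x = −16π|x₁|² + 8π|x₂|² − 16π|x₃|²` of the pencil `(D_K, G_K)` diagonal, citing the vanishing of the
off-diagonal `ℓ`-slopes from the certified record (repair/num-1 L11 §3, kit j251235). This file PROVES it: for
every `u = x₁k₁ + x₂k₂ + x₃k₃` in `ker 𝔅 = span{e^{−iπjy}}_{j=1,2,3}`,

  `d/dℓ F_ℓ(u)|_{ℓ=1} = ellSlopeQ x₁ x₂ x₃`        (`hasDerivAt_mainTermFormEll_afeComb`),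

i.e. the first-order `ℓ`-deformation of the manuscript's main-term form restricted to its kernel is EXACTLY the
diagonal form `D_K` — so, with `integral_normSq_afeComb` (`G_K`) and `ellSlopeQ_ge` / `ellSlopeQ_eigenvector`
(`μ₁ = min D_K/G_K`), the C2a statement «`λ_min(F_{1+ε})` splits off the triple zero of `𝔅` at rate
`μ₁ = −4π²(π+√(9π²−64))/(π²−8)` to first order on `K`» has all its finite ingredients in the kernel.

Method: `F_ℓ(u) = c₀ + c₁ℓ + c₂ℓ² + c₃ℓ³` (`MainTermFormEll.mainTermFormEll`) with `c₁ = 48 Im⟨u′,u⟩ + 16 Im(a₀ā₁)`,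
`c₂ = 88π‖u‖² − 24π Re(Ī(a₀+a₁))`, `c₃ = 48π² Im⟨u, Su⟩`; every inner product of two combinations of the `k_j` is a
combination of the five modes `1, k₁, k̄₁, k₂, k̄₂` (`afeComb_mul_conj_afeComb`) whose integrals are `1, 2/(πi),
conj(2/(πi)), 0, 0` (`integral_modes`); `∫₀ˣ u = Σ x_j(k_j(x) − 1)/c_j` (`primitive_afeComb`); then
`c₁ + 2c₂ + 3c₃ = ellSlopeQ x` is an identity in `Re/Im x_j` and `π`. Theorems only; no new `Prop` facts.
-/

noncomputable section

open Real Complex ComplexConjugate MeasureTheory Set intervalIntegral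

namespace Literature.NumberTheory.LFunctions.Zhang2022

namespace Objective


/-- `‖z‖² = Re² + Im²`. [folklore] -/
private theorem normSq_re_im' (z : ℂ) : ‖z‖ ^ 2 = z.re ^ 2 + z.im ^ 2 := by
  rw [Complex.sq_norm, Complex.normSq_apply]; ring

/-! ## Mode expansions and their integrals -/

/-- Bilinear mode expansion: `(Σ x_a k_a)·conj(Σ w_b k_b) = (Σ x_a w̄_a) + (x₂w̄₁ + x₃w̄₂)k₁ + (x₁w̄₂ + x₂w̄₃)k̄₁
+ x₃w̄₁ k₂ + x₁w̄₃ k̄₂`. [cite: Zhang2022LandauSiegel, §2 (2.13)] -/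
theorem afeComb_mul_conj_afeComb (x₁ x₂ x₃ w₁ w₂ w₃ : ℂ) (y : ℝ) :
    (x₁ * afeDir 1 y + x₂ * afeDir 2 y + x₃ * afeDir 3 y) *
        conj (w₁ * afeDir 1 y + w₂ * afeDir 2 y + w₃ * afeDir 3 y) =
      (x₁ * conj w₁ + x₂ * conj w₂ + x₃ * conj w₃)
        + (x₂ * conj w₁ + x₃ * conj w₂) * afeDir 1 y
        + (x₁ * conj w₂ + x₂ * conj w₃) * conj (afeDir 1 y)
        + (x₃ * conj w₁) * afeDir 2 y + (x₁ * conj w₃) * conj (afeDir 2 y) := by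
  have h11 := afeDir_mul_conj 1 y
  have h22 := afeDir_mul_conj 2 y
  have h33 := afeDir_mul_conj 3 y
  have h21 : afeDir 2 y * conj (afeDir 1 y) = afeDir 1 y := afeDir_mul_conj_afeDir_of_le (by norm_num) y
  have h32 : afeDir 3 y * conj (afeDir 2 y) = afeDir 1 y := afeDir_mul_conj_afeDir_of_le (by norm_num) y
  have h31 : afeDir 3 y * conj (afeDir 1 y) = afeDir 2 y := afeDir_mul_conj_afeDir_of_le (by norm_num) y
  have h12 : afeDir 1 y * conj (afeDir 2 y) = conj (afeDir 1 y) := afeDir_mul_conj_afeDir_of_ge (by norm_num) y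
  have h23 : afeDir 2 y * conj (afeDir 3 y) = conj (afeDir 1 y) := afeDir_mul_conj_afeDir_of_ge (by norm_num) y
  have h13 : afeDir 1 y * conj (afeDir 3 y) = conj (afeDir 2 y) := afeDir_mul_conj_afeDir_of_ge (by norm_num) y
  simp only [map_add, map_mul]
  linear_combination (x₁ * conj w₁) * h11 + (x₂ * conj w₂) * h22 + (x₃ * conj w₃) * h33
    + (x₂ * conj w₁) * h21 + (x₃ * conj w₂) * h32 + (x₃ * conj w₁) * h31
    + (x₁ * conj w₂) * h12 + (x₂ * conj w₃) * h23 + (x₁ * conj w₃) * h13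

/-- interval integrability of the basis directions on `[0, t]`. [folklore] -/
private theorem ii_afeDir' (m : ℕ) (a b : ℝ) : IntervalIntegrable (afeDir m) volume a b :=
  (continuous_afeDir m).intervalIntegrable a b

/-- interval integrability of their conjugates. [folklore] -/
private theorem ii_conj_afeDir' (m : ℕ) : IntervalIntegrable (fun y => conj (afeDir m y)) volume 0 1 :=
  (Complex.continuous_conj.comp (continuous_afeDir m)).intervalIntegrable 0 1

/-- `∫₀¹ conj k_m = conj ∫₀¹ k_m`. [folklore] -/
private theorem integral_conj_afeDir' (m : ℕ) :
    ∫ y in (0:ℝ)..1, conj (afeDir m y) = conj (∫ y in (0:ℝ)..1, afeDir m y) := by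
  rw [intervalIntegral.integral_of_le zero_le_one, intervalIntegral.integral_of_le zero_le_one, integral_conj]

/-- **Integrals of the five modes**: `∫₀¹ (A + Bk₁ + Ck̄₁ + Dk₂ + Ek̄₂) = A + B·(2/(πi)) + C·conj(2/(πi))`.
[cite: Zhang2022LandauSiegel, §2 (2.13)] -/
theorem integral_modes (A B C D E : ℂ) :
    ∫ y in (0:ℝ)..1, (A + B * afeDir 1 y + C * conj (afeDir 1 y) + D * afeDir 2 y + E * conj (afeDir 2 y)) =
      A + B * (2 / ((π : ℂ) * Complex.I)) + C * conj (2 / ((π : ℂ) * Complex.I)) := by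
  have I1 := integral_afeDir_one
  have I2 := integral_afeDir_two
  have I1c : ∫ y in (0:ℝ)..1, conj (afeDir 1 y) = conj (2 / ((π : ℂ) * Complex.I)) := by
    rw [integral_conj_afeDir', I1]
  have I2c : ∫ y in (0:ℝ)..1, conj (afeDir 2 y) = 0 := by rw [integral_conj_afeDir', I2, map_zero]
  have hA := (intervalIntegrable_const (μ := volume) (a := (0:ℝ)) (b := 1) (c := A))
  have hB := (ii_afeDir' 1 0 1).const_mul B
  have hC := (ii_conj_afeDir' 1).const_mul C
  have hD := (ii_afeDir' 2 0 1).const_mul D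
  have hE := (ii_conj_afeDir' 2).const_mul E
  rw [intervalIntegral.integral_add (((hA.add hB).add hC).add hD) hE,
    intervalIntegral.integral_add ((hA.add hB).add hC) hD,
    intervalIntegral.integral_add (hA.add hB) hC,
    intervalIntegral.integral_add hA hB,
    intervalIntegral.integral_const_mul, intervalIntegral.integral_const_mul,
    intervalIntegral.integral_const_mul, intervalIntegral.integral_const_mul,
    intervalIntegral.integral_const, I1, I1c, I2, I2c]
  simp

/-- `∫₀¹ k₃ = 2/(3πi)`. [cite: Zhang2022LandauSiegel, §2 (2.13)] -/
theorem integral_afeDir_three : ∫ y in (0:ℝ)..1, afeDir 3 y = 2 / (3 * (π : ℂ) * Complex.I) := by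
  rw [primitive_afeDir (by norm_num : (3:ℕ) ≠ 0), afeDir_one]
  unfold afeFreq
  have hπ : (π : ℂ) ≠ 0 := Complex.ofReal_ne_zero.mpr Real.pi_ne_zero
  push_cast
  field_simp
  ring

/-- `∫₀¹ (x₁k₁ + x₂k₂ + x₃k₃) = x₁·2/(πi) + x₃·2/(3πi)`. [cite: Zhang2022LandauSiegel, §2 (2.13)] -/
theorem integral_afeComb (x₁ x₂ x₃ : ℂ) :
    ∫ y in (0:ℝ)..1, (x₁ * afeDir 1 y + x₂ * afeDir 2 y + x₃ * afeDir 3 y) =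
      x₁ * (2 / ((π : ℂ) * Complex.I)) + x₃ * (2 / (3 * (π : ℂ) * Complex.I)) := by
  have h1 := (ii_afeDir' 1 0 1).const_mul x₁
  have h2 := (ii_afeDir' 2 0 1).const_mul x₂
  have h3 := (ii_afeDir' 3 0 1).const_mul x₃
  rw [intervalIntegral.integral_add (h1.add h2) h3, intervalIntegral.integral_add h1 h2,
    intervalIntegral.integral_const_mul, intervalIntegral.integral_const_mul, intervalIntegral.integral_const_mul,
    integral_afeDir_one, integral_afeDir_two, integral_afeDir_three]
  ring

/-- **The primitive**: `∫₀ᵗ (x₁k₁ + x₂k₂ + x₃k₃) = Σ x_j (k_j(t) − 1)/c_j` (`primitive_afeDir`).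
[cite: Zhang2022LandauSiegel, §2 (2.13)] -/
theorem primitive_afeComb (x₁ x₂ x₃ : ℂ) (t : ℝ) :
    ∫ s in (0:ℝ)..t, (x₁ * afeDir 1 s + x₂ * afeDir 2 s + x₃ * afeDir 3 s) =
      x₁ * ((afeDir 1 t - 1) / afeFreq 1) + x₂ * ((afeDir 2 t - 1) / afeFreq 2)
        + x₃ * ((afeDir 3 t - 1) / afeFreq 3) := by
  have h1 := (ii_afeDir' 1 0 t).const_mul x₁
  have h2 := (ii_afeDir' 2 0 t).const_mul x₂
  have h3 := (ii_afeDir' 3 0 t).const_mul x₃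
  rw [intervalIntegral.integral_add (h1.add h2) h3, intervalIntegral.integral_add h1 h2,
    intervalIntegral.integral_const_mul, intervalIntegral.integral_const_mul, intervalIntegral.integral_const_mul,
    primitive_afeDir one_ne_zero, primitive_afeDir two_ne_zero, primitive_afeDir (by norm_num : (3:ℕ) ≠ 0)]

/-- Six modes: `∫₀¹ (A + Bk₁ + Ck̄₁ + Dk₂ + Ek̄₂ + Fk₃) = A + B·(2/(πi)) + C·conj(2/(πi)) + F·2/(3πi)`.
[cite: Zhang2022LandauSiegel, §2 (2.13)] -/
theorem integral_modes6 (A B C D E F : ℂ) :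
    ∫ y in (0:ℝ)..1, (A + B * afeDir 1 y + C * conj (afeDir 1 y) + D * afeDir 2 y + E * conj (afeDir 2 y)
        + F * afeDir 3 y) =
      A + B * (2 / ((π : ℂ) * Complex.I)) + C * conj (2 / ((π : ℂ) * Complex.I))
        + F * (2 / (3 * (π : ℂ) * Complex.I)) := by
  have h5 : IntervalIntegrable (fun y => A + B * afeDir 1 y + C * conj (afeDir 1 y) + D * afeDir 2 y
      + E * conj (afeDir 2 y)) volume 0 1 :=
    ((((intervalIntegrable_const (μ := volume) (a := (0:ℝ)) (b := 1) (c := A)).add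
      ((ii_afeDir' 1 0 1).const_mul B)).add ((ii_conj_afeDir' 1).const_mul C)).add
      ((ii_afeDir' 2 0 1).const_mul D)).add ((ii_conj_afeDir' 2).const_mul E)
  have h6 := (ii_afeDir' 3 0 1).const_mul F
  rw [intervalIntegral.integral_add h5 h6, integral_modes, intervalIntegral.integral_const_mul,
    integral_afeDir_three]

/-! ## The two `ℓ`-weighted inner products on the kernel -/

/-- `⟨u′, u⟩ = ∫₀¹ u′ū` for `u = Σ x_j k_j` (`u′ = Σ x_j c_j k_j`): a five-mode integral.
[cite: Zhang2022LandauSiegel, §2 (2.10), (2.13)] -/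
theorem integral_afeComb'_mul_conj (x₁ x₂ x₃ : ℂ) :
    ∫ y in (0:ℝ)..1, (x₁ * afeDir' 1 y + x₂ * afeDir' 2 y + x₃ * afeDir' 3 y) *
        conj (x₁ * afeDir 1 y + x₂ * afeDir 2 y + x₃ * afeDir 3 y) =
      (x₁ * afeFreq 1 * conj x₁ + x₂ * afeFreq 2 * conj x₂ + x₃ * afeFreq 3 * conj x₃)
        + (x₂ * afeFreq 2 * conj x₁ + x₃ * afeFreq 3 * conj x₂) * (2 / ((π : ℂ) * Complex.I))
        + (x₁ * afeFreq 1 * conj x₂ + x₂ * afeFreq 2 * conj x₃) * conj (2 / ((π : ℂ) * Complex.I)) := by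
  have hpt : ∀ y : ℝ, (x₁ * afeDir' 1 y + x₂ * afeDir' 2 y + x₃ * afeDir' 3 y) *
      conj (x₁ * afeDir 1 y + x₂ * afeDir 2 y + x₃ * afeDir 3 y) =
      (x₁ * afeFreq 1 * conj x₁ + x₂ * afeFreq 2 * conj x₂ + x₃ * afeFreq 3 * conj x₃)
        + (x₂ * afeFreq 2 * conj x₁ + x₃ * afeFreq 3 * conj x₂) * afeDir 1 y
        + (x₁ * afeFreq 1 * conj x₂ + x₂ * afeFreq 2 * conj x₃) * conj (afeDir 1 y)
        + (x₃ * afeFreq 3 * conj x₁) * afeDir 2 y + (x₁ * afeFreq 1 * conj x₃) * conj (afeDir 2 y) := by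
    intro y
    have e : x₁ * afeDir' 1 y + x₂ * afeDir' 2 y + x₃ * afeDir' 3 y =
        (x₁ * afeFreq 1) * afeDir 1 y + (x₂ * afeFreq 2) * afeDir 2 y + (x₃ * afeFreq 3) * afeDir 3 y := by
      simp only [afeDir']; ring
    rw [e, afeComb_mul_conj_afeComb]
  simp_rw [hpt]
  exact integral_modes _ _ _ _ _

/-- `⟨u, Su⟩ = ∫₀¹ u(y)·conj(∫₀ʸ u) dy` for `u = Σ x_j k_j`: a six-mode integral (`w_j = x_j/c_j`, `W = Σ w_j`).
[cite: Zhang2022LandauSiegel, §2 (2.10), (2.13)] -/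
theorem integral_afeComb_mul_conj_primitive (x₁ x₂ x₃ : ℂ) :
    ∫ y in (0:ℝ)..1, (x₁ * afeDir 1 y + x₂ * afeDir 2 y + x₃ * afeDir 3 y) *
        conj (∫ s in (0:ℝ)..y, (x₁ * afeDir 1 s + x₂ * afeDir 2 s + x₃ * afeDir 3 s)) =
      (x₁ * conj (x₁ / afeFreq 1) + x₂ * conj (x₂ / afeFreq 2) + x₃ * conj (x₃ / afeFreq 3))
        + ((x₂ * conj (x₁ / afeFreq 1) + x₃ * conj (x₂ / afeFreq 2))
            - conj (x₁ / afeFreq 1 + x₂ / afeFreq 2 + x₃ / afeFreq 3) * x₁) * (2 / ((π : ℂ) * Complex.I))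
        + (x₁ * conj (x₂ / afeFreq 2) + x₂ * conj (x₃ / afeFreq 3)) * conj (2 / ((π : ℂ) * Complex.I))
        + (-(conj (x₁ / afeFreq 1 + x₂ / afeFreq 2 + x₃ / afeFreq 3) * x₃)) * (2 / (3 * (π : ℂ) * Complex.I)) := by
  have hpt : ∀ y : ℝ, (x₁ * afeDir 1 y + x₂ * afeDir 2 y + x₃ * afeDir 3 y) *
      conj (∫ s in (0:ℝ)..y, (x₁ * afeDir 1 s + x₂ * afeDir 2 s + x₃ * afeDir 3 s)) =
      (x₁ * conj (x₁ / afeFreq 1) + x₂ * conj (x₂ / afeFreq 2) + x₃ * conj (x₃ / afeFreq 3))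
        + ((x₂ * conj (x₁ / afeFreq 1) + x₃ * conj (x₂ / afeFreq 2))
            - conj (x₁ / afeFreq 1 + x₂ / afeFreq 2 + x₃ / afeFreq 3) * x₁) * afeDir 1 y
        + (x₁ * conj (x₂ / afeFreq 2) + x₂ * conj (x₃ / afeFreq 3)) * conj (afeDir 1 y)
        + (x₃ * conj (x₁ / afeFreq 1) - conj (x₁ / afeFreq 1 + x₂ / afeFreq 2 + x₃ / afeFreq 3) * x₂)
            * afeDir 2 y
        + (x₁ * conj (x₃ / afeFreq 3)) * conj (afeDir 2 y)
        + (-(conj (x₁ / afeFreq 1 + x₂ / afeFreq 2 + x₃ / afeFreq 3) * x₃)) * afeDir 3 y := by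
    intro y
    have hp : ∫ s in (0:ℝ)..y, (x₁ * afeDir 1 s + x₂ * afeDir 2 s + x₃ * afeDir 3 s) =
        ((x₁ / afeFreq 1) * afeDir 1 y + (x₂ / afeFreq 2) * afeDir 2 y + (x₃ / afeFreq 3) * afeDir 3 y)
          - (x₁ / afeFreq 1 + x₂ / afeFreq 2 + x₃ / afeFreq 3) := by
      rw [primitive_afeComb]; ring
    have hm := afeComb_mul_conj_afeComb x₁ x₂ x₃ (x₁ / afeFreq 1) (x₂ / afeFreq 2) (x₃ / afeFreq 3) y
    rw [hp, map_sub, mul_sub, hm]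
    ring
  simp_rw [hpt]
  rw [integral_modes6]

/-! ## The slope form on the kernel is `D_K` -/

/-- `2/(πi) = −(2/π)i`. [folklore] -/
private theorem two_div_pi_I : (2 : ℂ) / ((π : ℂ) * Complex.I) = ((-(2 / π) : ℝ) : ℂ) * Complex.I := by
  have hne : (π : ℂ) * Complex.I ≠ 0 := mul_ne_zero (Complex.ofReal_ne_zero.mpr Real.pi_ne_zero) Complex.I_ne_zero
  rw [div_eq_iff hne]
  push_cast
  have hπ : (π : ℂ) ≠ 0 := Complex.ofReal_ne_zero.mpr Real.pi_ne_zero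
  field_simp
  ring_nf
  rw [Complex.I_sq]
  ring

/-- `2/(3πi) = −(2/(3π))i`. [folklore] -/
private theorem two_div_three_pi_I :
    (2 : ℂ) / (3 * (π : ℂ) * Complex.I) = ((-(2 / (3 * π)) : ℝ) : ℂ) * Complex.I := by
  have hne : 3 * (π : ℂ) * Complex.I ≠ 0 :=
    mul_ne_zero (mul_ne_zero three_ne_zero (Complex.ofReal_ne_zero.mpr Real.pi_ne_zero)) Complex.I_ne_zero
  rw [div_eq_iff hne]
  push_cast
  have hπ : (π : ℂ) ≠ 0 := Complex.ofReal_ne_zero.mpr Real.pi_ne_zero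
  field_simp
  ring_nf
  rw [Complex.I_sq]
  ring

/-- `x / c_j = x·(1/(jπ))·i` (`c_j = −iπj`). [folklore] -/
private theorem div_afeFreq (x : ℂ) {j : ℕ} (hj : j ≠ 0) :
    x / afeFreq j = x * (((1 / (j * π)) : ℝ) : ℂ) * Complex.I := by
  have hc := afeFreq_ne_zero hj
  rw [div_eq_iff hc]
  unfold afeFreq
  push_cast
  have hπ : (π : ℂ) ≠ 0 := Complex.ofReal_ne_zero.mpr Real.pi_ne_zero
  have hjc : (j : ℂ) ≠ 0 := Nat.cast_ne_zero.mpr hj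
  field_simp
  ring_nf
  rw [Complex.I_sq]
  ring

/-- `c_j = −(jπ)·i`. [folklore] -/
private theorem afeFreq_eq (j : ℕ) : afeFreq j = ((-(j * π) : ℝ) : ℂ) * Complex.I := by
  unfold afeFreq; push_cast; ring

/-- A cubic in `ℓ` has derivative `c₁ + 2c₂ + 3c₃` at `ℓ = 1`. [folklore] -/
private theorem hasDerivAt_cubic (c₀ c₁ c₂ c₃ : ℝ) :
    HasDerivAt (fun ℓ : ℝ => c₀ + ℓ * c₁ + ℓ ^ 2 * c₂ + ℓ ^ 3 * c₃) (c₁ + 2 * c₂ + 3 * c₃) 1 := by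
  have h1 : HasDerivAt (fun ℓ : ℝ => ℓ * c₁) (1 * c₁) 1 := (hasDerivAt_id (1:ℝ)).mul_const c₁
  have h2 : HasDerivAt (fun ℓ : ℝ => ℓ ^ 2 * c₂) (((2:ℕ) : ℝ) * 1 ^ (2 - 1) * c₂) 1 :=
    (hasDerivAt_pow 2 (1:ℝ)).mul_const c₂
  have h3 : HasDerivAt (fun ℓ : ℝ => ℓ ^ 3 * c₃) (((3:ℕ) : ℝ) * 1 ^ (3 - 1) * c₃) 1 :=
    (hasDerivAt_pow 3 (1:ℝ)).mul_const c₃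
  have h := (((hasDerivAt_const (1:ℝ) c₀).add h1).add h2).add h3
  refine h.congr_deriv ?_
  norm_num

/-- **`D_K` IS the `ℓ`-slope form of `F_ℓ` on `ker 𝔅`.** For every `u = x₁k₁ + x₂k₂ + x₃k₃` (with its derivative
`u′ = Σ x_j k_j′`), `ℓ ↦ F_ℓ(u)` (`mainTermFormEll`) has derivative `ellSlopeQ x₁ x₂ x₃ = −16π|x₁|² + 8π|x₂|² −
16π|x₃|²` at `ℓ = 1` — the off-diagonal slopes vanish (record repair/num-1 L11 §3, kit j251235: the cross terms have
a double root at `ℓ = 1`), so the first-order splitting pencil of C2a is exactly `(ellSlopeQ, kernelGramQ)`.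
[cite: Zhang2022LandauSiegel, §2 (2.10), (2.13)] -/
theorem hasDerivAt_mainTermFormEll_afeComb (x₁ x₂ x₃ : ℂ) :
    HasDerivAt (fun ℓ : ℝ => mainTermFormEll ℓ (fun y => x₁ * afeDir 1 y + x₂ * afeDir 2 y + x₃ * afeDir 3 y)
      (fun y => x₁ * afeDir' 1 y + x₂ * afeDir' 2 y + x₃ * afeDir' 3 y)) (ellSlopeQ x₁ x₂ x₃) 1 := by
  set u : ℝ → ℂ := fun y => x₁ * afeDir 1 y + x₂ * afeDir 2 y + x₃ * afeDir 3 y with hu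
  set u' : ℝ → ℂ := fun y => x₁ * afeDir' 1 y + x₂ * afeDir' 2 y + x₃ * afeDir' 3 y with hu'
  -- the four `ℓ`-coefficients of `F_ℓ(u)`
  set c₀ : ℝ := 8 / π * (∫ x in (0:ℝ)..1, ‖u' x‖ ^ 2) with hc₀
  set c₁ : ℝ := 48 * (∫ x in (0:ℝ)..1, u' x * conj (u x)).im + 16 * (u 0 * conj (u 1)).im with hc₁
  set c₂ : ℝ := 88 * π * (∫ x in (0:ℝ)..1, ‖u x‖ ^ 2)
      - 24 * π * (conj (∫ t in (0:ℝ)..1, u t) * (u 0 + u 1)).re with hc₂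
  set c₃ : ℝ := 48 * π ^ 2 * (∫ x in (0:ℝ)..1, u x * conj (∫ t in (0:ℝ)..x, u t)).im with hc₃
  have e : (fun ℓ : ℝ => mainTermFormEll ℓ u u') = fun ℓ => c₀ + ℓ * c₁ + ℓ ^ 2 * c₂ + ℓ ^ 3 * c₃ := by
    funext ℓ; rfl
  rw [e]
  refine (hasDerivAt_cubic c₀ c₁ c₂ c₃).congr_deriv ?_
  -- the values of the ingredients
  have hT1 := integral_afeComb'_mul_conj x₁ x₂ x₃
  have hG := integral_normSq_afeComb x₁ x₂ x₃
  have hI := integral_afeComb x₁ x₂ x₃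
  have hT4 := integral_afeComb_mul_conj_primitive x₁ x₂ x₃
  have hu0 : u 0 = x₁ + x₂ + x₃ := by simp [hu, afeDir_zero]
  have hu1 : u 1 = -x₁ + x₂ - x₃ := by
    simp only [hu, afeDir_one]; ring
  simp only [hu] at hT1 hG hI hT4 hu0 hu1 ⊢
  rw [hc₁, hc₂, hc₃]
  simp only [hu, hu']
  rw [hT1, hG, hI, hT4, hu0, hu1, ellSlopeQ_eq, kernelGramQ]
  -- normalise the constants to the shape `(real)·i`
  rw [div_afeFreq x₁ one_ne_zero, div_afeFreq x₂ two_ne_zero, div_afeFreq x₃ (by norm_num : (3:ℕ) ≠ 0),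
    two_div_pi_I, two_div_three_pi_I, afeFreq_eq 1, afeFreq_eq 2, afeFreq_eq 3]
  have hπ : π ≠ 0 := Real.pi_ne_zero
  simp only [map_add, map_mul, Complex.conj_ofReal, Complex.conj_I, normSq_re_im', Complex.add_re, Complex.add_im,
    Complex.sub_re, Complex.sub_im, Complex.mul_re, Complex.mul_im, Complex.neg_re, Complex.neg_im, Complex.I_re,
    Complex.I_im, Complex.ofReal_re, Complex.ofReal_im, Complex.conj_re, Complex.conj_im]
  push_cast
  field_simp
  ring

/-- **C2a assembled in the kernel**: on `ker 𝔅`, the `ℓ`-slope of `F_ℓ` at `ℓ = 1` (`= ellSlopeQ x`, previous theorem)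
is bounded below by `μ₁` times the `L²` norm — `μ₁·∫₀¹‖u‖² ≤ d/dℓ F_ℓ(u)|₁` for every `u = Σ x_j k_j` — with
`μ₁ = −4π²(π+√(9π²−64))/(π²−8) ∈ (−171.5502, −171.55)` (`ellSlopeMin_bounds`) and equality at the eigenvector of
`ellSlopeQ_eigenvector`: the exact first-order rate at which the manuscript's main-term form loses positivity on the
physical side `ℓ > 1` (record μ₁ = −171.5500948955, repair/num-1 L11 §3). [cite: Zhang2022LandauSiegel, §2 (2.10), (2.13)] -/
theorem ellSlopeMin_mul_normSq_le_slope (x₁ x₂ x₃ : ℂ) :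
    ellSlopeMin * (∫ y in (0:ℝ)..1, ‖x₁ * afeDir 1 y + x₂ * afeDir 2 y + x₃ * afeDir 3 y‖ ^ 2)
      ≤ ellSlopeQ x₁ x₂ x₃ := by
  rw [integral_normSq_afeComb]
  exact ellSlopeQ_ge x₁ x₂ x₃

end Objective

end Literature.NumberTheory.LFunctions.Zhang2022
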